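import Literature.NumberTheory.Automorphic.QuaternionCoordOrderAdelicLiftProofs
import Literature.NumberTheory.Automorphic.AdicCompletionCompact
import HarnessLib

/-!
# Ramified local places: anisotropy and coercivity of the norm form of `ℍ[K_v,a,b]`

Topic `NumberTheory/Automorphic`; theorems only (no definition, no named fact). Local inputs at
the places `v` **ramified** in `ℍ[K,a,b]` for Kneser's strong approximation theorem (Vignéras,
LNM 800, Ch. III §4, proof of Thm. 4.3), where no conjugation is available to move an element
close to `±1`: closeness must come from the norm form itself.

* `eq_zero_of_normForm_eq_zero_of_not_exists` : if `b = s² - a t²` has **no** solution in a field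
  `F` (`2 ≠ 0`, `a b ≠ 0`) then the norm form `z₀² - a z₁² - b z₂² + ab z₃²` of `ℍ[F,a,b]` is
  **anisotropic** (`ℍ[F,a,b]` is a division algebra; Vignéras I §2 Cor. 2.4: `H ≃ M(2,K)` iff
  `H` is not a field iff the norm form represents `0`); with `isSplitAt_quaternionAlgebra_iff`
  this is the case at the finite places ramified in `ℍ[K,a,b]`.
* `exists_forall_valued_sq_le_of_anisotropic` : **coercivity** — over `K_v` an anisotropic norm
  form `Q` satisfies `|zᵢ|² ≤ C |Q(z)|` for a constant `C` (compactness of the unit sphere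
  `{max |zᵢ| = 1}` of `K_v⁴`, on which `|Q|` is bounded below, and homogeneity; Vignéras II §1
  Lemme 1.4: `v ∘ n` is a discrete valuation of the local division algebra, whose valuation ring
  is the maximal order — a lattice).
* `valued_sq_le_of_mul_star_eq_one` : hence **a norm-one element of a local division quaternion
  algebra whose reduced trace is close to `2` is close to `1`**: `n(y - 1) = 2 - t(y)`, so
  `|(y - 1)ᵢ|² ≤ C |2 y₀ - 2|` for every coordinate.

## References

* M.-F. Vignéras, *Arithmétique des algèbres de quaternions*, LNM 800 (1980), Ch. I §2 Cor. 2.4,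
  Ch. II §1 Lemme 1.4, Ch. III §4 (proof of Thm. 4.3) [VignerasLNM800].
-/

noncomputable section

open scoped Quaternion WithZero Topology
open NumberField IsDedekindDomain

namespace Literature.NumberTheory.Automorphic

namespace QuaternionAlgebra

/-! ### Anisotropy of the norm form when `b ∉ N(F(√a))` -/

section Field

variable {F : Type*} [Field F]

/-- Brahmagupta's identity for the binary form `x² - a y²`. [folklore] -/
theorem sq_sub_mul_sq_mul_sq_sub_mul_sq (a z₀ z₁ z₂ z₃ : F) :
    (z₀ * z₂ - a * z₁ * z₃) ^ 2 - a * (z₁ * z₂ - z₀ * z₃) ^ 2 =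
      (z₀ ^ 2 - a * z₁ ^ 2) * (z₂ ^ 2 - a * z₃ ^ 2) := by
  ring

/-- If `a = c²` is a non-zero square (`2 ≠ 0`) then `b = s² - a t²` is solvable:
`s = (1 + b)/2`, `t = (1 - b)/(2c)`. [folklore] -/
theorem exists_sq_sub_mul_sq_of_isSquare [NeZero (2 : F)] {a : F} (ha : a ≠ 0) (hsq : IsSquare a)
    (b : F) : ∃ s t : F, s ^ 2 - a * t ^ 2 = b := by
  obtain ⟨c, rfl⟩ := hsq
  have hc : c ≠ 0 := fun h => ha (by rw [h, mul_zero])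
  have h2 : (2 : F) ≠ 0 := two_ne_zero
  refine ⟨(1 + b) / 2, (1 - b) / (2 * c), ?_⟩
  field_simp
  ring

/-- **Anisotropy of the norm form of a non-split `ℍ[F,a,b]`** (`2 ≠ 0`, `a ≠ 0`): if
`b = s² - a t²` has no solution in `F`, then `z₀² - a z₁² - b z₂² + ab z₃² = 0` only for
`z = 0` — i.e. `ℍ[F,a,b]` is a division algebra (Vignéras I §2 Cor. 2.4: the norm form of
`{a, b}` represents `0` iff `{a, b} ≃ M(2, F)` iff `b ∈ n(F(√a))`).
[cite: VignerasLNM800, Ch. I §2 Cor. 2.4] -/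
theorem eq_zero_of_normForm_eq_zero_of_not_exists [NeZero (2 : F)] {a b : F} (ha : a ≠ 0)
    (hns : ¬ ∃ s t : F, s ^ 2 - a * t ^ 2 = b) {z₀ z₁ z₂ z₃ : F}
    (hz : z₀ ^ 2 - a * z₁ ^ 2 - b * z₂ ^ 2 + a * b * z₃ ^ 2 = 0) :
    z₀ = 0 ∧ z₁ = 0 ∧ z₂ = 0 ∧ z₃ = 0 := by
  have hnsq : ¬ IsSquare a := fun h => hns (exists_sq_sub_mul_sq_of_isSquare ha h b)
  have hN : z₀ ^ 2 - a * z₁ ^ 2 = b * (z₂ ^ 2 - a * z₃ ^ 2) := by linear_combination hz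
  by_cases hN₂ : z₂ ^ 2 - a * z₃ ^ 2 = 0
  · -- then `a z₃² = z₂²` and `a z₁² = z₀²`; `a` not a square forces `z = 0`
    have hz3 : z₃ = 0 := by
      by_contra h3
      exact hnsq ⟨z₂ / z₃, by field_simp; linear_combination -hN₂⟩
    have hz2 : z₂ = 0 := by
      rw [hz3] at hN₂
      exact pow_eq_zero_iff (n := 2) two_ne_zero |>.mp (by linear_combination hN₂)
    have hN₁ : z₀ ^ 2 - a * z₁ ^ 2 = 0 := by rw [hN, hN₂, mul_zero]
    have hz1 : z₁ = 0 := by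
      by_contra h1
      exact hnsq ⟨z₀ / z₁, by field_simp; linear_combination -hN₁⟩
    have hz0 : z₀ = 0 := by
      rw [hz1] at hN₁
      exact pow_eq_zero_iff (n := 2) two_ne_zero |>.mp (by linear_combination hN₁)
    exact ⟨hz0, hz1, hz2, hz3⟩
  · -- otherwise `b` is a norm: contradiction
    exfalso
    refine hns ⟨(z₀ * z₂ - a * z₁ * z₃) / (z₂ ^ 2 - a * z₃ ^ 2),
      (z₁ * z₂ - z₀ * z₃) / (z₂ ^ 2 - a * z₃ ^ 2), ?_⟩
    rw [div_pow, div_pow, ← mul_div_assoc, div_sub_div_same, div_eq_iff (pow_ne_zero 2 hN₂)]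
    linear_combination sq_sub_mul_sq_mul_sq_sub_mul_sq a z₀ z₁ z₂ z₃ + (z₂ ^ 2 - a * z₃ ^ 2) * hN

end Field

/-! ### Coercivity of an anisotropic norm form over `K_v` -/

section Local

variable (K : Type) [Field K] [NumberField K] (v : HeightOneSpectrum (𝓞 K))

/-- `K_v`. -/
local notation "Kᵥ" => HeightOneSpectrum.adicCompletion K v

/-- Closed balls `{x : |x| ≤ |η|}` of `K_v` are closed. [folklore] -/
theorem isClosed_valued_le (η : Kᵥ) : IsClosed {x : Kᵥ | Valued.v x ≤ Valued.v η} := by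
  have h := Valued.isClosed_closedBall Kᵥ (Valued.v.restrict η)
  simp only [Valuation.restrict_le_iff] at h
  exact h

/-- The closed unit ball `𝒪_v` of `K_v` is compact (`AdicCompletionCompact`). [folklore] -/
theorem isCompact_valued_le_one : IsCompact {x : Kᵥ | Valued.v x ≤ 1} := by
  haveI : CompactSpace (v.adicCompletionIntegers K) := compactSpace_adicCompletionIntegers' K v
  have h : {x : Kᵥ | Valued.v x ≤ 1} = Set.range ((↑) : v.adicCompletionIntegers K → Kᵥ) := by
    ext x
    simp only [Set.mem_setOf_eq, Set.mem_range]
    constructor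
    · intro hx
      exact ⟨⟨x, (HeightOneSpectrum.mem_adicCompletionIntegers (𝓞 K) K v).mpr hx⟩, rfl⟩
    · rintro ⟨y, rfl⟩
      exact (HeightOneSpectrum.mem_adicCompletionIntegers (𝓞 K) K v).mp y.2
  rw [h]
  exact isCompact_range continuous_subtype_val

/-- The unit sphere `{x : |x| = 1}` of `K_v` is closed. [folklore] -/
theorem isClosed_valued_eq_one : IsClosed {x : Kᵥ | Valued.v x = 1} := by
  have h : {x : Kᵥ | Valued.v x = 1} = {x : Kᵥ | Valued.v x ≤ Valued.v (1 : Kᵥ)} ∩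
      {x : Kᵥ | Valued.v x < 1}ᶜ := by
    ext x
    simp only [Set.mem_setOf_eq, Set.mem_inter_iff, Set.mem_compl_iff, map_one, not_lt,
      le_antisymm_iff]
  rw [h]
  exact (isClosed_valued_le K v 1).inter (isOpen_valued_lt_one v).isClosed_compl

/-- Powers of a uniformiser: `K_v` contains `π` with `|πⁿ| = q_v⁻ⁿ` for all `n`. [folklore] -/
theorem exists_forall_valued_pow_eq : ∃ π : Kᵥ, ∀ n : ℕ, Valued.v (π ^ n) = WithZero.exp (-(n : ℤ)) := by
  obtain ⟨π, hπ⟩ := v.valuation_exists_uniformizer K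
  refine ⟨algebraMap K Kᵥ π, fun n => ?_⟩
  have hπv : Valued.v (algebraMap K Kᵥ π) = WithZero.exp (-1 : ℤ) := by
    rw [← hπ]
    exact HeightOneSpectrum.valuedAdicCompletion_eq_valuation' v π
  rw [map_pow, hπv, ← WithZero.exp_nsmul, smul_neg, nsmul_eq_mul, mul_one]

/-- **Coercivity of an anisotropic norm form over `K_v`**: if `z₀² - a z₁² - b z₂² + ab z₃² = 0`
only for `z = 0`, there is `N` with `|zᵢ|² ≤ q_v^N |z₀² - a z₁² - b z₂² + ab z₃²|` for all `z`
and `i` (on the compact unit sphere `{max |zᵢ| = 1}` the valuation of the form is bounded below —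
finite subcover of `{|Q| > q_v⁻ⁿ}` — and the form is homogeneous of degree `2`; Vignéras II §1
Lemme 1.4: for the local division algebra `v ∘ n` is a valuation and `{n(h) ∈ R}` is a lattice).
[cite: VignerasLNM800, Ch. II §1 Lemme 1.4] -/
theorem exists_forall_valued_sq_le_of_anisotropic {a b : Kᵥ}
    (han : ∀ z₀ z₁ z₂ z₃ : Kᵥ, z₀ ^ 2 - a * z₁ ^ 2 - b * z₂ ^ 2 + a * b * z₃ ^ 2 = 0 →
      z₀ = 0 ∧ z₁ = 0 ∧ z₂ = 0 ∧ z₃ = 0) :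
    ∃ N : ℕ, ∀ z : Fin 4 → Kᵥ, ∀ i,
      Valued.v (z i) ^ 2 ≤ WithZero.exp (N : ℤ) *
        Valued.v (z 0 ^ 2 - a * z 1 ^ 2 - b * z 2 ^ 2 + a * b * z 3 ^ 2) := by
  -- the form, its continuity, homogeneity and anisotropy
  set Q : (Fin 4 → Kᵥ) → Kᵥ := fun z => z 0 ^ 2 - a * z 1 ^ 2 - b * z 2 ^ 2 + a * b * z 3 ^ 2
    with hQ
  have hQc : Continuous Q := by rw [hQ]; fun_prop
  have hQsmul : ∀ (c : Kᵥ) (z : Fin 4 → Kᵥ), Q (c • z) = c ^ 2 * Q z := fun c z => by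
    simp only [hQ, Pi.smul_apply, smul_eq_mul]; ring
  have hQ0 : ∀ z, Q z = 0 → ∀ i, z i = 0 := fun z hz i => by
    obtain ⟨h0, h1, h2, h3⟩ := han (z 0) (z 1) (z 2) (z 3) hz
    fin_cases i <;> assumption
  -- the compact unit sphere
  set S : Set (Fin 4 → Kᵥ) := Set.pi Set.univ (fun _ : Fin 4 => {x : Kᵥ | Valued.v x ≤ 1}) ∩
    ⋃ i : Fin 4, {z : Fin 4 → Kᵥ | Valued.v (z i) = 1} with hS
  have hE : ∀ i : Fin 4, IsClosed {z : Fin 4 → Kᵥ | Valued.v (z i) = 1} := fun i => by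
    have hci : Continuous fun z : Fin 4 → Kᵥ => z i := continuous_apply i
    exact (isClosed_valued_eq_one K v).preimage hci
  have hSc : IsCompact S :=
    (isCompact_univ_pi fun _ => isCompact_valued_le_one K v).inter_right
      (isClosed_iUnion_of_finite hE)
  -- the open cover `U n = {|Q| > q_v⁻ⁿ}`
  obtain ⟨π, hπ⟩ := exists_forall_valued_pow_eq K v
  set U : ℕ → Set (Fin 4 → Kᵥ) := fun n => {z | WithZero.exp (-(n : ℤ)) < Valued.v (Q z)} with hU
  have hUo : ∀ n, IsOpen (U n) := fun n => by
    have h : U n = Q ⁻¹' {x : Kᵥ | Valued.v x ≤ Valued.v (π ^ n)}ᶜ := by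
      ext z
      simp only [hU, Set.mem_setOf_eq, Set.mem_preimage, Set.mem_compl_iff, hπ n, not_le]
    rw [h]
    exact (isClosed_valued_le K v (π ^ n)).isOpen_compl.preimage hQc
  have hsU : S ⊆ ⋃ n, U n := by
    intro z hz
    obtain ⟨-, hz1⟩ := hz
    rw [Set.mem_iUnion] at hz1 ⊢
    obtain ⟨i, hi⟩ := hz1
    have hzi : z i ≠ 0 := fun h => by
      rw [Set.mem_setOf_eq, h, map_zero] at hi
      exact zero_ne_one hi
    have hQz : Valued.v (Q z) ≠ 0 := (Valuation.ne_zero_iff _).mpr fun h => hzi (hQ0 z h i)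
    set m : ℤ := WithZero.log (Valued.v (Q z)) with hm
    refine ⟨(-m).toNat + 1, ?_⟩
    simp only [hU, Set.mem_setOf_eq]
    rw [← WithZero.exp_log hQz, WithZero.exp_lt_exp, ← hm]
    have h := Int.self_le_toNat (-m)
    push_cast
    omega
  have hdU : Directed (· ⊆ ·) U := by
    refine Monotone.directed_le fun m n hmn z hz => ?_
    simp only [hU, Set.mem_setOf_eq] at hz ⊢
    refine lt_of_le_of_lt ?_ hz
    rw [WithZero.exp_le_exp]
    omega
  obtain ⟨N, hN⟩ := hSc.elim_directed_cover U hUo hsU hdU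
  refine ⟨N, fun z i => ?_⟩
  change Valued.v (z i) ^ 2 ≤ WithZero.exp (N : ℤ) * Valued.v (Q z)
  by_cases hz : ∀ j, z j = 0
  · rw [hz i, map_zero, zero_pow two_ne_zero]
    exact zero_le
  -- normalise by the largest coordinate `λ = z j₀`
  obtain ⟨j₀, -, hj₀⟩ := Finset.exists_max_image Finset.univ (fun j => Valued.v (z j))
    Finset.univ_nonempty
  set lam := z j₀ with hlam
  have hlam0 : lam ≠ 0 := by
    intro h
    apply hz
    intro j
    have h' := hj₀ j (Finset.mem_univ j)
    rw [h, map_zero, le_zero_iff, Valuation.zero_iff] at h'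
    exact h'
  have hvlam : Valued.v lam ≠ 0 := (Valuation.ne_zero_iff _).mpr hlam0
  have hmemS : lam⁻¹ • z ∈ S := by
    refine ⟨fun j _ => ?_, Set.mem_iUnion.mpr ⟨j₀, ?_⟩⟩
    · simp only [Set.mem_setOf_eq, Pi.smul_apply, smul_eq_mul, map_mul, map_inv₀]
      rw [inv_mul_le_iff₀ (zero_lt_iff.mpr hvlam), mul_one]
      exact hj₀ j (Finset.mem_univ j)
    · simp only [Set.mem_setOf_eq, Pi.smul_apply, smul_eq_mul, ← hlam, inv_mul_cancel₀ hlam0,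
        map_one]
  have hkey := hN hmemS
  simp only [hU, Set.mem_setOf_eq, hQsmul, map_mul, map_pow, map_inv₀] at hkey
  -- `q⁻ᴺ < |λ|⁻² |Q z|`, so `|z i|² ≤ |λ|² ≤ qᴺ |Q z|`
  have hzi : Valued.v (z i) ^ 2 ≤ Valued.v lam ^ 2 := by
    rw [pow_two, pow_two]
    exact mul_le_mul' (hj₀ i (Finset.mem_univ i)) (hj₀ i (Finset.mem_univ i))
  refine hzi.trans ?_
  have h1 : Valued.v lam ^ 2 * WithZero.exp (-(N : ℤ)) ≤ Valued.v (Q z) := by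
    calc Valued.v lam ^ 2 * WithZero.exp (-(N : ℤ))
        ≤ Valued.v lam ^ 2 * ((Valued.v lam)⁻¹ ^ 2 * Valued.v (Q z)) := mul_le_mul' le_rfl hkey.le
      _ = Valued.v (Q z) := by
          rw [← mul_assoc, inv_pow, mul_inv_cancel₀ (pow_ne_zero 2 hvlam), one_mul]
  calc Valued.v lam ^ 2 = Valued.v lam ^ 2 * WithZero.exp (-(N : ℤ)) * WithZero.exp (N : ℤ) := by
        rw [mul_assoc, ← WithZero.exp_add, neg_add_cancel, WithZero.exp_zero, mul_one]
    _ ≤ Valued.v (Q z) * WithZero.exp (N : ℤ) := mul_le_mul' h1 le_rfl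
    _ = WithZero.exp (N : ℤ) * Valued.v (Q z) := mul_comm _ _

/-- **A norm-one element of trace close to `2` is close to `1`** in an anisotropic `ℍ[K_v,a,b]`:
with `N` as in `exists_forall_valued_sq_le_of_anisotropic`, every `y` with `y ȳ = 1` satisfies
`|(y - 1)ᵢ|² ≤ q_v^N |2 y₀ - 2|` for each coordinate, because `n(y - 1) = 2 - t(y)`
(Vignéras III §4, proof of Thm. 4.3 at the ramified places: an element of `H_w¹` with trace close
to `2` is close to `1`). [cite: VignerasLNM800, Ch. III §4 (proof of Thm. 4.3)] -/
theorem valued_sq_le_of_mul_star_eq_one {a b : Kᵥ} {N : ℕ}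
    (hN : ∀ z : Fin 4 → Kᵥ, ∀ i, Valued.v (z i) ^ 2 ≤ WithZero.exp (N : ℤ) *
      Valued.v (z 0 ^ 2 - a * z 1 ^ 2 - b * z 2 ^ 2 + a * b * z 3 ^ 2))
    (y : ℍ[Kᵥ,a,b]) (hy : y * star y = 1) :
    Valued.v (y.re - 1) ^ 2 ≤ WithZero.exp (N : ℤ) * Valued.v (2 * y.re - 2) ∧
    Valued.v y.imI ^ 2 ≤ WithZero.exp (N : ℤ) * Valued.v (2 * y.re - 2) ∧
    Valued.v y.imJ ^ 2 ≤ WithZero.exp (N : ℤ) * Valued.v (2 * y.re - 2) ∧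
    Valued.v y.imK ^ 2 ≤ WithZero.exp (N : ℤ) * Valued.v (2 * y.re - 2) := by
  have hn : y.re ^ 2 - a * y.imI ^ 2 - b * y.imJ ^ 2 + a * b * y.imK ^ 2 = 1 :=
    (mul_star_eq_one_iff_coords y).mp hy
  -- `n(y - 1) = 2 - 2 y₀`, up to sign `2 y₀ - 2`
  have hQ : (y.re - 1) ^ 2 - a * y.imI ^ 2 - b * y.imJ ^ 2 + a * b * y.imK ^ 2 = -(2 * y.re - 2) := by
    linear_combination hn
  have hv : Valued.v ((y.re - 1) ^ 2 - a * y.imI ^ 2 - b * y.imJ ^ 2 + a * b * y.imK ^ 2) =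
      Valued.v (2 * y.re - 2) := by rw [hQ, Valuation.map_neg]
  have h := hN ![y.re - 1, y.imI, y.imJ, y.imK]
  simp only [Matrix.cons_val_zero, Matrix.cons_val_one, Matrix.cons_val] at h
  refine ⟨?_, ?_, ?_, ?_⟩
  · have h0 := h 0; simp only [Matrix.cons_val_zero] at h0; rwa [hv] at h0
  · have h1 := h 1; simp only [Matrix.cons_val_one, Matrix.cons_val_zero] at h1; rwa [hv] at h1
  · have h2 := h 2; simp only [Matrix.cons_val] at h2; rwa [hv] at h2
  · have h3 := h 3; simp only [Matrix.cons_val] at h3; rwa [hv] at h3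

end Local

end QuaternionAlgebra

end Literature.NumberTheory.Automorphic
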